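import Mathlib
import Summits.Ventures.PercRepro2.Defs
import Summits.Ventures.PercRepro2.Graph
import Summits.Ventures.PercRepro2.OneColourSwitch
import Summits.Ventures.PercRepro2.M9PendantMirror
import Summits.Ventures.PercRepro2.M9LoopTransfer
import Summits.Ventures.PercRepro2.M9PendantSeries
import Summits.Ventures.PercRepro2.M9ReducibleClass
import Summits.Ventures.PercRepro2.M9ParallelContract
import Summits.Ventures.PercRepro2.M9ReducibleSP
import Summits.Ventures.PercRepro2.M9NoPocketDefs
import Summits.Ventures.PercRepro2.M9NoPocketM9
import Summits.Ventures.PercRepro2.M9ReducibleNP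
import Summits.Ventures.PercRepro2.M9NoPocketSetDefs
import Summits.Ventures.PercRepro2.M9NoPocketSetM9
import Summits.Ventures.PercRepro2.M9ReducibleNPS
import Summits.Ventures.PercRepro2.TermSwitchDefs
import Summits.Ventures.PercRepro2.TermSwitchM9
import Summits.Ventures.PercRepro2.TermSwitchClass

/-!
# The series–parallel reducible class with the «behind `{r, s}`» base (blind cell PercRepro2,
p3 g21, 2026-08-27; `proofs/P3-CPNC.md` §18d)

`ReducibleNPSB p q r s ends` is `ReducibleNPS` (`M9ReducibleNPS`: the `DZero`, cut-vertex,
no-pocket single-`d` and multi-`d` bases, the pair swap, the pendant, series and parallel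
reductions) with ONE MORE BASE: the class of `TermSwitchClass` — a region `Z ∌ p, q` that an
edge can only leave through `r` or `s`, a disjoint region `Z' ∌ r, s` that an edge can only
leave through `p` or `q`, every other non-mark adjacent to `p` or `q` or with at most one
non-loop edge (the vertices of `Z`, `Z'` of any degree and adjacency, doubly reachable).  `m9SignSum_nonpos_of_reducibleNPSB`
proves `Σ_{Sep} σ_pq · σ_rs ≤ 0` on the whole class.  Own work, one seat.
-/

namespace Summit.Ventures.PercRepro2

namespace M9Reduce

open OneColourSwitch Classical Finset SideSwitch

variable {V : Type*} {E : Type*}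

section ReducibleNPSB

variable [Fintype V] [DecidableEq V] [Fintype E] [DecidableEq E]

/-- The series–parallel reducible class with the «behind `{r, s}`» base. -/
inductive ReducibleNPSB : V → V → V → V → (E → Sym2 V) → Prop
  /-- every `ReducibleNPS` graph -/
  | ofReducibleNPS {p q r s : V} {ends : E → Sym2 V} (h : ReducibleNPS p q r s ends) :
      ReducibleNPSB p q r s ends
  /-- the «behind» class: a region `Z ∌ p, q` that an edge can only leave through `r` or `s`, a
  disjoint region `Z' ∌ r, s` that an edge can only leave through `p` or `q`, every other
  non-mark adjacent to `p` or `q` or with at most one non-loop edge -/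
  | behind {p q r s : V} {Z Z' : Set V} {ends : E → Sym2 V}
      (hZ : TermSwitch.BehindRS ends r s Z) (hpZ : p ∉ Z) (hqZ : q ∉ Z)
      (hZ' : TermSwitch.BehindRS ends p q Z') (hrZ' : r ∉ Z') (hsZ' : s ∉ Z')
      (hdisj : ∀ x, x ∈ Z → x ∉ Z')
      (hadj : ∀ x, Nonmark p q r s x → x ∉ Z → x ∉ Z' →
        (∃ e, ends e = s(x, p) ∨ ends e = s(x, q)) ∨ (nonloopEdges ends x).card ≤ 1) :
      ReducibleNPSB p q r s ends
  /-- the pair swap -/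
  | swap {p q r s : V} {ends : E → Sym2 V} (h : ReducibleNPSB r s p q ends) :
      ReducibleNPSB p q r s ends
  /-- the pendant reduction -/
  | pendant {p q r s : V} {ends : E → Sym2 V} {e₀ : E} {d v : V}
      (hd : ∀ e, d ∈ ends e → ¬ (ends e).IsDiag → e = e₀) (he₀ : ends e₀ = s(d, v))
      (hp : p ≠ d) (hq : q ≠ d) (hr : r ≠ d) (hs : s ≠ d)
      (h : ReducibleNPSB p q r s (Function.update ends e₀ s(d, d))) : ReducibleNPSB p q r s ends
  /-- the series reduction -/
  | series {p q r s : V} {ends : E → Sym2 V} {e₁ e₂ : E} {d x y : V} (hne : e₁ ≠ e₂)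
      (hd : ∀ e, d ∈ ends e → ¬ (ends e).IsDiag → e = e₁ ∨ e = e₂)
      (h₁ : ends e₁ = s(d, x)) (h₂ : ends e₂ = s(d, y)) (hx : x ≠ d) (hy : y ≠ d)
      (hp : p ≠ d) (hq : q ≠ d) (hr : r ≠ d) (hs : s ≠ d)
      (hG₁ : ReducibleNPSB p q r s (Function.update (Function.update ends e₁ s(x, y)) e₂ s(d, d)))
      (hG₀ : ReducibleNPSB p q r s (Function.update (Function.update ends e₁ s(d, d)) e₂ s(d, d))) :
      ReducibleNPSB p q r s ends
  /-- the parallel reduction -/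
  | parallel {p q r s : V} {ends : E → Sym2 V} {e₁ e₂ : E} {x y : V} (hne : e₁ ≠ e₂)
      (h₁ : ends e₁ = s(x, y)) (h₂ : ends e₂ = s(x, y))
      (hp : p ≠ y) (hq : q ≠ y) (hr : r ≠ y) (hs : s ≠ y)
      (hG₁ : ReducibleNPSB p q r s (Function.update ends e₂ s(x, x)))
      (hGc : ReducibleNPSB p q r s (contract ends x y)) : ReducibleNPSB p q r s ends

/-- **`m9` in sign form on the reducible class with the «behind `{r, s}`» base**:
`Σ_{Sep} σ_pq · σ_rs ≤ 0` on every marked multigraph that series–parallel-reduces at non-marks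
to a `DZero` graph, a cut-vertex graph, a no-pocket single-`d` or multi-`d` graph, or a graph
whose non-marks are adjacent to `p` or `q` or lie in a region behind `{r, s}`. -/
theorem m9SignSum_nonpos_of_reducibleNPSB {p q r s : V} {ends : E → Sym2 V}
    (h : ReducibleNPSB p q r s ends) : m9SignSum ends p q r s ≤ 0 := by
  induction h with
  | ofReducibleNPS h => exact m9SignSum_nonpos_of_reducibleNPS h
  | behind hZ hpZ hqZ hZ' hrZ' hsZ' hdisj hadj =>
    exact TermSwitch.m9SignSum_nonpos_of_adj_or_behind hZ hpZ hqZ hZ' hrZ' hsZ' hdisj hadj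
  | swap _ ih => rw [m9SignSum_comm]; exact ih
  | pendant hd he₀ hp hq hr hs _ ih => rw [m9SignSum_pendant hd he₀ hp hq hr hs]; exact ih
  | series hne hd h₁ h₂ hx hy hp hq hr hs _ _ ih₁ ih₀ =>
    have hid := m9SignSum_series hne hd h₁ h₂ hx hy hp hq hr hs
    linarith
  | parallel hne h₁ h₂ hp hq hr hs _ _ ih₁ ihc =>
    exact m9SignSum_nonpos_of_parallel hne h₁ h₂ hp hq hr hs ih₁ ihc

end ReducibleNPSB

end M9Reduce

end Summit.Ventures.PercRepro2
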